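import Summits.AtomisticToContinuum.HydrodynamicLimit.Theorems.TwoClocksEquilibriumFastWindowLDBirthT12FarFieldContraction
import HarnessLib

/-!
# Compositions of DIFFERENT zonal operators on `S²`: the Legendre multipliers multiply, and the sup-norm
# duality bound on the sector `ℓ ≥ 2`
# (helpers `t12_comp_zonal_legendre`, `t12_comp_zonal_contraction_sup` of the line `birth`, crux
# `TwoClocks.EquilibriumFastWindowLD`, stmt-AtomisticToContinuum-14440; §6 FF6 ingredient (i) of the
# registered analytic sub-goal `t12_logLinearPreimage_and_dipoleModulus`)

`…T12FarFieldContraction/B` bound the ITERATES `K^j` of ONE zonal operator `(K F)(x) = ∫_{S²} k(⟪x, ω⟫) F(ω) dσ(ω)`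
on the sector `ℓ ≥ 2` of `L^∞(S²)` by `Σ_{ℓ≥2} (2ℓ+1)/2 ‖P_ℓ‖_{L¹[-1,1]} |λ_ℓ|^j`, `λ_ℓ = 2π ∫_{-1}^{1} k P_ℓ`. Plan §6 FF6
composes DIFFERENT steps (each collision step, an `x`-average of circle averages, is a zonal operator with its
own weight `k_i ∈ L¹[-1, 1]`). Here the composite `K_{k_{j-1}} ∘ ⋯ ∘ K_{k_0}` of a sequence of zonal operators is
written WITHOUT a new definition as `List.foldl (fun F i x => ∫ k_i(⟪x, ω⟫) F(ω) dσ(ω)) Y (List.range j)` (`k_0`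
acts FIRST on the profile `Y`), and:

* **`foldl_zonal_legendre`** (registered `t12_comp_zonal_legendre`) — the multipliers multiply:
  `(K_{k_{j-1}} ⋯ K_{k_0} P_ℓ(⟪n', ·⟫))(n) = (Π_{i<j} λ_ℓ(k_i)) P_ℓ(⟪n, n'⟫)` (iterated Funk–Hecke; `k_i ∈ L¹`);
* **`abs_foldl_zonal_le_of_orthogonal`** (registered `t12_comp_zonal_contraction_sup`) — for `k_0` measurable
  and BOUNDED on `[-1, 1]`, `k_1, …, k_{j-1}` measurable and integrable on `[-1, 1]`, and
  `Σ_{ℓ=2}^{N+1} (2ℓ+1)/2 ‖P_ℓ‖₁ Π_{i<j} |λ_ℓ(k_i)| ≤ θ` (all `N`): every bounded measurable `Y` (`|Y| ≤ m` on the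
  unit sphere) with zero zonal average and zero dipole moment has `|(K_{k_{j-1}} ⋯ K_{k_0} Y)(n)| ≤ θ m` at unit
  `n` — the plan's "`m Σ_{ℓ≥2} c_ℓ Π_i |P_ℓ(ρ_i)|`" with EXACTLY the constant of the one-kernel case.

PROOF. Only the innermost weight is expanded (`K_{k_0} Y = Σ_{ℓ<L} a_ℓ Π_ℓ Y + R_L`, `a_ℓ = (2ℓ+1)/2 ∫ k_0 P_ℓ`,
`|R_L| ≤ 2π‖k_0 − S_L k_0‖₁ m → 0` by `t12_legendre_series_L1`, `Π_ℓ Y := ∫ P_ℓ(⟪·, ω'⟫) Y(ω') dσ(ω')`), thanks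
to the commutation **`integral_sphere_zonal_mul_legendreOp`**: EVERY zonal operator with an `L¹` weight acts on
`Π_ℓ Y` as the scalar `λ_ℓ(k)` (Fubini on `S² × S²` + Funk–Hecke for `P_ℓ` — Funk–Hecke in degree `ℓ` without
spherical harmonics, `(2ℓ+1)/(4π) Π_ℓ` being the degree-`ℓ` projection). So the outer steps carry
`Σ a_ℓ (Πλ) Π_ℓ Y + O((Π 2π‖k_i‖₁) 2π‖R‖₁ m)` along (`abs_zonal_sub_sum_legendreOp_le`), and pairing at `n`:
`Π_0 Y(n) = Π_1 Y(n) = 0`, `|Π_ℓ Y(n)| ≤ 2π‖P_ℓ‖₁ m`, `|a_ℓ| 2π‖P_ℓ‖₁ = (2ℓ+1)/2 ‖P_ℓ‖₁ |λ_ℓ(k_0)|`.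
HYPOTHESES ON THE WEIGHTS: outer weights measurable + `IntervalIntegrable` on `[-1, 1]` only (inverse-square-root
singularities of fold-back Jacobians are admitted); innermost weight measurable + bounded on `[-1, 1]` (for a
merely integrable weight the Fourier–Legendre partial sums need not converge in `L¹`). All statements are
[folklore] (Funk 1916 / Hecke 1918; `L^∞ → L^∞` duality for zonal kernels).
-/

noncomputable section

open MeasureTheory Real Set Filter Metric Polynomial Topology
open scoped ENNReal BigOperators InnerProductSpace
namespace Summit.AtomisticToContinuum.HydrodynamicLimit.Theorems.ClampedCorrectorBirth

open Literature.Analysis.FluidPDE Literature.MathematicalPhysics.KineticTheory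
  Literature.Analysis.SpecialFunctions

/-! ### The degree-`ℓ` component `Π_ℓ Y = ∫ P_ℓ(⟪·, ω'⟫) Y(ω') dσ(ω')` and its Funk–Hecke multipliers -/

/-- Legendre polynomials are uniformly bounded on the heights `⟪x, y⟫` of pairs of unit vectors. [folklore] -/
theorem exists_bound_legendre_inner (ℓ : ℕ) : ∃ C : ℝ, 0 ≤ C ∧ ∀ x y : EuclideanSpace ℝ (Fin 3),
    ‖x‖ = 1 → ‖y‖ = 1 → |(legendre ℓ).eval ⟪x, y⟫_ℝ| ≤ C := by
  obtain ⟨C, hC⟩ := (isCompact_Icc (a := (-1:ℝ)) (b := 1)).exists_bound_of_continuousOn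
    (legendre ℓ).continuous.continuousOn
  refine ⟨max C 0, le_max_right _ _, fun x y hx hy => ?_⟩
  have h := hC _ (inner_mem_Icc_of_norm_eq_one hx hy)
  rw [Real.norm_eq_abs] at h
  exact h.trans (le_max_left _ _)

/-- `Π_ℓ Y = ∫ P_ℓ(⟪·, ω'⟫) Y(ω') dσ(ω')` is measurable for measurable `Y`. [folklore] -/
theorem measurable_legendreOp (ℓ : ℕ) {Y : EuclideanSpace ℝ (Fin 3) → ℝ} (hY : Measurable Y) :
    Measurable fun x : EuclideanSpace ℝ (Fin 3) => ∫ ω' : sphere (0 : EuclideanSpace ℝ (Fin 3)) 1,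
      (legendre ℓ).eval ⟪x, (ω' : EuclideanSpace ℝ (Fin 3))⟫_ℝ * Y ω' ∂sphereMeasure :=
  measurable_integral_sphere_zonal_mul (k := fun t => (legendre ℓ).eval t) (legendre ℓ).continuous.measurable hY

/-- `|Π_ℓ Y| ≤ 2π ‖P_ℓ‖_{L¹[-1,1]} m` on the unit sphere for `|Y| ≤ m` there. [folklore] -/
theorem abs_legendreOp_le (ℓ : ℕ) {Y : EuclideanSpace ℝ (Fin 3) → ℝ} {m : ℝ}
    (hm : ∀ y : EuclideanSpace ℝ (Fin 3), ‖y‖ = 1 → |Y y| ≤ m) {x : EuclideanSpace ℝ (Fin 3)} (hx : ‖x‖ = 1) :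
    |∫ ω' : sphere (0 : EuclideanSpace ℝ (Fin 3)) 1,
        (legendre ℓ).eval ⟪x, (ω' : EuclideanSpace ℝ (Fin 3))⟫_ℝ * Y ω' ∂sphereMeasure| ≤
      (2 * π * ∫ t in (-1:ℝ)..1, |(legendre ℓ).eval t|) * m :=
  abs_integral_sphere_zonal_mul_le (k := fun t => (legendre ℓ).eval t) hx
    ((legendre ℓ).continuous.intervalIntegrable _ _) hm

/-- **Zonal operators act on `Π_ℓ Y` by their Legendre multiplier.** For unit `x`, a zonal weight `k`
(measurable, integrable on `[-1, 1]`) and a bounded measurable profile `Y`: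
`∫ k(⟪x, ω⟫) (Π_ℓ Y)(ω) dσ(ω) = λ_ℓ(k) (Π_ℓ Y)(x)`, `λ_ℓ(k) = 2π ∫_{-1}^{1} k P_ℓ`,
`Π_ℓ Y = ∫ P_ℓ(⟪·, ω'⟫) Y(ω') dσ(ω')` — Fubini on `S² × S²` and Funk–Hecke for `P_ℓ(⟪ω', ·⟫)`; as `(2ℓ+1)/(4π) Π_ℓ`
is the projection onto the degree-`ℓ` spherical harmonics, this is Funk–Hecke in degree `ℓ` without them. [folklore] -/
theorem integral_sphere_zonal_mul_legendreOp (ℓ : ℕ) {x : EuclideanSpace ℝ (Fin 3)} (hx : ‖x‖ = 1)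
    {k : ℝ → ℝ} (hk : Measurable k) (hkI : IntervalIntegrable k volume (-1) 1)
    {Y : EuclideanSpace ℝ (Fin 3) → ℝ} (hY : Measurable Y) {m : ℝ}
    (hm : ∀ y : EuclideanSpace ℝ (Fin 3), ‖y‖ = 1 → |Y y| ≤ m) :
    ∫ ω : sphere (0 : EuclideanSpace ℝ (Fin 3)) 1, k ⟪x, (ω : EuclideanSpace ℝ (Fin 3))⟫_ℝ *
        (∫ ω' : sphere (0 : EuclideanSpace ℝ (Fin 3)) 1,
          (legendre ℓ).eval ⟪(ω : EuclideanSpace ℝ (Fin 3)), (ω' : EuclideanSpace ℝ (Fin 3))⟫_ℝ * Y ω'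
            ∂sphereMeasure) ∂sphereMeasure =
      (2 * π * ∫ z in (-1:ℝ)..1, k z * (legendre ℓ).eval z) *
        ∫ ω' : sphere (0 : EuclideanSpace ℝ (Fin 3)) 1,
          (legendre ℓ).eval ⟪x, (ω' : EuclideanSpace ℝ (Fin 3))⟫_ℝ * Y ω' ∂sphereMeasure := by
  haveI := isFiniteMeasure_sphereMeasure (E := EuclideanSpace ℝ (Fin 3))
  obtain ⟨C, hC0, hC⟩ := exists_bound_legendre_inner ℓ
  -- integrability on `S² × S²`: the integrand is dominated by `|k(⟪x, ω⟫)| · C m`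
  have hint : Integrable (Function.uncurry fun (ω : sphere (0 : EuclideanSpace ℝ (Fin 3)) 1)
      (ω' : sphere (0 : EuclideanSpace ℝ (Fin 3)) 1) =>
      k ⟪x, (ω : EuclideanSpace ℝ (Fin 3))⟫_ℝ *
        ((legendre ℓ).eval ⟪(ω : EuclideanSpace ℝ (Fin 3)), (ω' : EuclideanSpace ℝ (Fin 3))⟫_ℝ * Y ω'))
      ((sphereMeasure : Measure (sphere (0 : EuclideanSpace ℝ (Fin 3)) 1)).prod sphereMeasure) := by
    refine Integrable.mono' ((integrable_sphere_comp_inner_of_intervalIntegrable hx hkI).norm.mul_prod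
      (integrable_const (C * m))) ?_ (Eventually.of_forall fun p => ?_)
    · have h1 : Measurable fun p : sphere (0 : EuclideanSpace ℝ (Fin 3)) 1 × sphere (0 : EuclideanSpace ℝ (Fin 3)) 1 =>
          ⟪(p.1 : EuclideanSpace ℝ (Fin 3)), (p.2 : EuclideanSpace ℝ (Fin 3))⟫_ℝ :=
        ((continuous_subtype_val.comp continuous_fst).inner
          (continuous_subtype_val.comp continuous_snd)).measurable
      have h2 : Measurable fun p : sphere (0 : EuclideanSpace ℝ (Fin 3)) 1 × sphere (0 : EuclideanSpace ℝ (Fin 3)) 1 =>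
          ⟪x, (p.1 : EuclideanSpace ℝ (Fin 3))⟫_ℝ :=
        (continuous_const.inner (continuous_subtype_val.comp continuous_fst)).measurable
      exact ((hk.comp h2).mul (((legendre ℓ).continuous.measurable.comp h1).mul
        (hY.comp (continuous_subtype_val.comp continuous_snd).measurable))).aestronglyMeasurable
    · have hp1 : ‖(p.1 : EuclideanSpace ℝ (Fin 3))‖ = 1 := by simp
      have hp2 : ‖(p.2 : EuclideanSpace ℝ (Fin 3))‖ = 1 := by simp
      rw [Function.uncurry_def, Real.norm_eq_abs, abs_mul, abs_mul, Real.norm_eq_abs]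
      exact mul_le_mul_of_nonneg_left (mul_le_mul (hC _ _ hp1 hp2) (hm _ hp2) (abs_nonneg _) hC0)
        (abs_nonneg _)
  simp_rw [← integral_const_mul]
  rw [integral_integral_swap hint]
  refine integral_congr_ae (Eventually.of_forall fun ω' => ?_)
  have hω' : ‖(ω' : EuclideanSpace ℝ (Fin 3))‖ = 1 := by simp
  have h1 : ∀ ω : sphere (0 : EuclideanSpace ℝ (Fin 3)) 1, k ⟪x, (ω : EuclideanSpace ℝ (Fin 3))⟫_ℝ *
      ((legendre ℓ).eval ⟪(ω : EuclideanSpace ℝ (Fin 3)), (ω' : EuclideanSpace ℝ (Fin 3))⟫_ℝ * Y ω') =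
      k ⟪x, (ω : EuclideanSpace ℝ (Fin 3))⟫_ℝ *
        (legendre ℓ).eval ⟪(ω' : EuclideanSpace ℝ (Fin 3)), (ω : EuclideanSpace ℝ (Fin 3))⟫_ℝ * Y ω' :=
    fun ω => by rw [real_inner_comm (ω' : EuclideanSpace ℝ (Fin 3))]; ring
  dsimp only
  rw [integral_congr_ae (Eventually.of_forall h1), integral_mul_const,
    integral_sphere_zonal_mul_legendre ℓ hx hω' hk hkI]
  ring

/-- **One zonal step along a finite Legendre resolution.** If `G` is measurable and
`|G − Σ_{l<L} b_l Π_l Y| ≤ ε` on the unit sphere (`Y` bounded measurable), then for a zonal weight `k`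
(measurable, integrable on `[-1, 1]`) and unit `x`:
`|(K_k G)(x) − Σ_{l<L} b_l λ_l(k) (Π_l Y)(x)| ≤ 2π‖k‖_{L¹[-1,1]} ε` — `K_k` is linear, multiplies `Π_l Y` by
`λ_l(k)` (`integral_sphere_zonal_mul_legendreOp`) and has sup-norm `≤ 2π‖k‖₁`. [folklore] -/
theorem abs_zonal_sub_sum_legendreOp_le {k : ℝ → ℝ} (hk : Measurable k) (hkI : IntervalIntegrable k volume (-1) 1)
    {Y : EuclideanSpace ℝ (Fin 3) → ℝ} (hY : Measurable Y) {m : ℝ}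
    (hm : ∀ y : EuclideanSpace ℝ (Fin 3), ‖y‖ = 1 → |Y y| ≤ m)
    {G : EuclideanSpace ℝ (Fin 3) → ℝ} (hG : Measurable G) (b : ℕ → ℝ) (L : ℕ) {ε : ℝ}
    (hε : ∀ y : EuclideanSpace ℝ (Fin 3), ‖y‖ = 1 →
      |G y - ∑ l ∈ Finset.range L, b l * ∫ ω' : sphere (0 : EuclideanSpace ℝ (Fin 3)) 1,
        (legendre l).eval ⟪y, (ω' : EuclideanSpace ℝ (Fin 3))⟫_ℝ * Y ω' ∂sphereMeasure| ≤ ε)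
    {x : EuclideanSpace ℝ (Fin 3)} (hx : ‖x‖ = 1) :
    |(∫ ω : sphere (0 : EuclideanSpace ℝ (Fin 3)) 1, k ⟪x, (ω : EuclideanSpace ℝ (Fin 3))⟫_ℝ * G ω ∂sphereMeasure) -
        ∑ l ∈ Finset.range L, (b l * (2 * π * ∫ z in (-1:ℝ)..1, k z * (legendre l).eval z)) *
          ∫ ω' : sphere (0 : EuclideanSpace ℝ (Fin 3)) 1,
            (legendre l).eval ⟪x, (ω' : EuclideanSpace ℝ (Fin 3))⟫_ℝ * Y ω' ∂sphereMeasure| ≤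
      (2 * π * ∫ t in (-1:ℝ)..1, |k t|) * ε := by
  set Ψ : ℕ → EuclideanSpace ℝ (Fin 3) → ℝ := fun l y => ∫ ω' : sphere (0 : EuclideanSpace ℝ (Fin 3)) 1,
    (legendre l).eval ⟪y, (ω' : EuclideanSpace ℝ (Fin 3))⟫_ℝ * Y ω' ∂sphereMeasure with hΨ
  set R : EuclideanSpace ℝ (Fin 3) → ℝ := fun y => G y - ∑ l ∈ Finset.range L, b l * Ψ l y with hR
  have hRm : Measurable R :=
    hG.sub (Finset.measurable_sum _ fun l _ => (measurable_legendreOp l hY).const_mul (b l))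
  have hdec : ∀ ω : sphere (0 : EuclideanSpace ℝ (Fin 3)) 1, k ⟪x, (ω : EuclideanSpace ℝ (Fin 3))⟫_ℝ * G ω =
      k ⟪x, (ω : EuclideanSpace ℝ (Fin 3))⟫_ℝ * R ω +
        ∑ l ∈ Finset.range L, b l * (k ⟪x, (ω : EuclideanSpace ℝ (Fin 3))⟫_ℝ * Ψ l ω) := fun ω => by
    have h : ∑ l ∈ Finset.range L, b l * (k ⟪x, (ω : EuclideanSpace ℝ (Fin 3))⟫_ℝ * Ψ l ω) =
        k ⟪x, (ω : EuclideanSpace ℝ (Fin 3))⟫_ℝ * ∑ l ∈ Finset.range L, b l * Ψ l ω := by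
      rw [Finset.mul_sum]; exact Finset.sum_congr rfl fun l _ => by ring
    rw [h, hR]; ring
  have hIR : Integrable (fun ω : sphere (0 : EuclideanSpace ℝ (Fin 3)) 1 =>
      k ⟪x, (ω : EuclideanSpace ℝ (Fin 3))⟫_ℝ * R ω) sphereMeasure :=
    integrable_sphere_zonal_mul hx hkI hRm hε
  have hIΨ : ∀ l, Integrable (fun ω : sphere (0 : EuclideanSpace ℝ (Fin 3)) 1 =>
      k ⟪x, (ω : EuclideanSpace ℝ (Fin 3))⟫_ℝ * Ψ l ω) sphereMeasure := fun l =>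
    integrable_sphere_zonal_mul hx hkI (measurable_legendreOp l hY) fun y hy => abs_legendreOp_le l hm hy
  have hsum : ∑ l ∈ Finset.range L, b l * ∫ ω : sphere (0 : EuclideanSpace ℝ (Fin 3)) 1,
      k ⟪x, (ω : EuclideanSpace ℝ (Fin 3))⟫_ℝ * Ψ l ω ∂sphereMeasure =
      ∑ l ∈ Finset.range L, (b l * (2 * π * ∫ z in (-1:ℝ)..1, k z * (legendre l).eval z)) * Ψ l x :=
    Finset.sum_congr rfl fun l _ => by rw [integral_sphere_zonal_mul_legendreOp l hx hk hkI hY hm]; ring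
  rw [integral_congr_ae (Eventually.of_forall hdec),
    integral_add hIR (integrable_finsetSum _ fun l _ => (hIΨ l).const_mul (b l)),
    integral_finsetSum _ fun l _ => (hIΨ l).const_mul (b l)]
  simp only [integral_const_mul]
  rw [hsum, add_sub_cancel_right]
  exact abs_integral_sphere_zonal_mul_le hx hkI hε

/-! ### The composite of a sequence of zonal operators -/

/-- The composite `K_{k_{j-1}} ∘ ⋯ ∘ K_{k_0}` of zonal operators with measurable weights maps measurable
profiles to measurable functions. [folklore] -/
theorem measurable_foldl_zonal {k : ℕ → ℝ → ℝ} {G : EuclideanSpace ℝ (Fin 3) → ℝ} (hG : Measurable G) (j : ℕ) :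
    (∀ i < j, Measurable (k i)) →
      Measurable (List.foldl (fun (F : EuclideanSpace ℝ (Fin 3) → ℝ) (i : ℕ) (x : EuclideanSpace ℝ (Fin 3)) =>
        ∫ ω : sphere (0 : EuclideanSpace ℝ (Fin 3)) 1, k i ⟪x, (ω : EuclideanSpace ℝ (Fin 3))⟫_ℝ * F ω ∂sphereMeasure)
        G (List.range j)) := by
  induction j with
  | zero => intro; simpa using hG
  | succ j ih =>
    intro hk
    simp only [List.range_succ, List.foldl_append, List.foldl_cons, List.foldl_nil]
    exact measurable_integral_sphere_zonal_mul (hk j (lt_add_one j)) (ih fun i hi => hk i (by omega))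

/-- **The Legendre multipliers of a composite of zonal operators multiply.** For unit `n, n'`, weights
`k_0, …, k_{j-1}` (measurable, integrable on `[-1, 1]`) and every `ℓ`:
`(K_{k_{j-1}} ⋯ K_{k_0} P_ℓ(⟪n', ·⟫))(n) = (Π_{i<j} 2π∫_{-1}^{1} k_i P_ℓ) · P_ℓ(⟪n, n'⟫)` — iterated Funk–Hecke
(`integral_sphere_zonal_mul_legendre`). [folklore] -/
theorem foldl_zonal_legendre (ℓ : ℕ) {n' : EuclideanSpace ℝ (Fin 3)} (hn' : ‖n'‖ = 1) {k : ℕ → ℝ → ℝ} (j : ℕ) :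
    (∀ i < j, Measurable (k i)) → (∀ i < j, IntervalIntegrable (k i) volume (-1) 1) →
      ∀ {n : EuclideanSpace ℝ (Fin 3)}, ‖n‖ = 1 →
      List.foldl (fun (F : EuclideanSpace ℝ (Fin 3) → ℝ) (i : ℕ) (x : EuclideanSpace ℝ (Fin 3)) =>
          ∫ ω : sphere (0 : EuclideanSpace ℝ (Fin 3)) 1, k i ⟪x, (ω : EuclideanSpace ℝ (Fin 3))⟫_ℝ * F ω ∂sphereMeasure)
          (fun x => (legendre ℓ).eval ⟪n', x⟫_ℝ) (List.range j) n =
        (∏ i ∈ Finset.range j, (2 * π * ∫ z in (-1:ℝ)..1, k i z * (legendre ℓ).eval z)) *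
          (legendre ℓ).eval ⟪n, n'⟫_ℝ := by
  induction j with
  | zero => intro _ _ n _; simp [real_inner_comm n n']
  | succ j ih =>
    intro hk hkI n hn
    simp only [List.range_succ, List.foldl_append, List.foldl_cons, List.foldl_nil]
    have h : ∀ ω : sphere (0 : EuclideanSpace ℝ (Fin 3)) 1, k j ⟪n, (ω : EuclideanSpace ℝ (Fin 3))⟫_ℝ *
        List.foldl (fun (F : EuclideanSpace ℝ (Fin 3) → ℝ) (i : ℕ) (x : EuclideanSpace ℝ (Fin 3)) =>
          ∫ ω : sphere (0 : EuclideanSpace ℝ (Fin 3)) 1, k i ⟪x, (ω : EuclideanSpace ℝ (Fin 3))⟫_ℝ * F ω ∂sphereMeasure)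
          (fun x => (legendre ℓ).eval ⟪n', x⟫_ℝ) (List.range j) ω =
        (∏ i ∈ Finset.range j, (2 * π * ∫ z in (-1:ℝ)..1, k i z * (legendre ℓ).eval z)) *
          (k j ⟪n, (ω : EuclideanSpace ℝ (Fin 3))⟫_ℝ *
            (legendre ℓ).eval ⟪n', (ω : EuclideanSpace ℝ (Fin 3))⟫_ℝ) := fun ω => by
      rw [ih (fun i hi => hk i (by omega)) (fun i hi => hkI i (by omega)) (by simp), real_inner_comm n']
      ring
    rw [integral_congr_ae (Eventually.of_forall h), integral_const_mul,
      integral_sphere_zonal_mul_legendre ℓ hn hn' (hk j (lt_add_one j)) (hkI j (lt_add_one j)),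
      Finset.prod_range_succ]
    ring

/-! ### The sup-norm duality bound on the sector `ℓ ≥ 2` -/

/-- **Sup-norm bound of a composite of zonal operators on the sector `ℓ ≥ 2`.** Let `k_0` be measurable with
`|k_0| ≤ M` on `[-1, 1]`, `k_1, …, k_{j-1}` measurable and integrable on `[-1, 1]` (`j ≥ 1`), and suppose
`Σ_{ℓ=2}^{N+1} (2ℓ+1)/2 ‖P_ℓ‖_{L¹[-1,1]} Π_{i<j} |λ_ℓ(k_i)| ≤ θ` for all `N`, `λ_ℓ(k) = 2π∫_{-1}^{1} k P_ℓ`. Then for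
every measurable `Y` with `|Y| ≤ m` on the unit sphere, `∫ Y dσ = 0` and `∫ Y(ω) ω dσ(ω) = 0`:
`|(K_{k_{j-1}} ⋯ K_{k_1} K_{k_0} Y)(n)| ≤ θ m` at every unit `n`. Proof: `K_{k_0} Y = Σ_{ℓ<L} a_ℓ Π_ℓ Y + R_L` with
`a_ℓ = (2ℓ+1)/2 ∫ k_0 P_ℓ`, `|R_L| ≤ 2π‖k_0 − S_L k_0‖₁ m` (Legendre series of `k_0` in `L¹`,
`tendsto_integral_abs_sub_legendreSum`); the outer steps multiply `Π_ℓ Y` by `λ_ℓ(k_i)` and the remainder by at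
most `2π‖k_i‖₁` (`abs_zonal_sub_sum_legendreOp_le`); finally `Π_0 Y(n) = Π_1 Y(n) = 0` and
`|Π_ℓ Y(n)| ≤ 2π‖P_ℓ‖₁ m`, `|a_ℓ| 2π‖P_ℓ‖₁ = (2ℓ+1)/2 ‖P_ℓ‖₁ |λ_ℓ(k_0)|`; let `L → ∞`. [folklore] -/
theorem abs_foldl_zonal_le_of_orthogonal {k : ℕ → ℝ → ℝ} {M : ℝ} {j : ℕ} (hj : 0 < j)
    (hk : ∀ i < j, Measurable (k i)) (hM : ∀ t ∈ Icc (-1:ℝ) 1, |k 0 t| ≤ M)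
    (hkI : ∀ i < j, IntervalIntegrable (k i) volume (-1) 1) {θ : ℝ}
    (hθ : ∀ N : ℕ, ∑ l ∈ Finset.range N, (2 * ((l + 2 : ℕ) : ℝ) + 1) / 2 *
      (∫ x in (-1:ℝ)..1, |(legendre (l + 2)).eval x|) *
      ∏ i ∈ Finset.range j, |2 * π * ∫ z in (-1:ℝ)..1, k i z * (legendre (l + 2)).eval z| ≤ θ)
    {Y : EuclideanSpace ℝ (Fin 3) → ℝ} (hY : Measurable Y) {m : ℝ}
    (hm : ∀ x : EuclideanSpace ℝ (Fin 3), ‖x‖ = 1 → |Y x| ≤ m)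
    (h0 : ∫ ω : sphere (0 : EuclideanSpace ℝ (Fin 3)) 1, Y ω ∂sphereMeasure = 0)
    (h1 : ∫ ω : sphere (0 : EuclideanSpace ℝ (Fin 3)) 1, Y ω • (ω : EuclideanSpace ℝ (Fin 3)) ∂sphereMeasure = 0)
    {n : EuclideanSpace ℝ (Fin 3)} (hn : ‖n‖ = 1) :
    |List.foldl (fun (F : EuclideanSpace ℝ (Fin 3) → ℝ) (i : ℕ) (x : EuclideanSpace ℝ (Fin 3)) =>
        ∫ ω : sphere (0 : EuclideanSpace ℝ (Fin 3)) 1, k i ⟪x, (ω : EuclideanSpace ℝ (Fin 3))⟫_ℝ * F ω ∂sphereMeasure)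
        Y (List.range j) n| ≤ θ * m := by
  obtain ⟨j, rfl⟩ : ∃ i, j = i + 1 := ⟨j - 1, by omega⟩
  haveI := isFiniteMeasure_sphereMeasure (E := EuclideanSpace ℝ (Fin 3))
  have hm0 : 0 ≤ m := (abs_nonneg _).trans (hm n hn)
  have hqm : Measurable (k 0) := hk 0 (by omega)
  have hqI : IntervalIntegrable (k 0) volume (-1) 1 := hkI 0 (by omega)
  -- peel the innermost step `k 0`
  simp only [List.range_succ_eq_map, List.foldl_cons, List.foldl_map, Nat.succ_eq_add_one]
  -- notation
  set G₀ : EuclideanSpace ℝ (Fin 3) → ℝ := fun x => ∫ ω : sphere (0 : EuclideanSpace ℝ (Fin 3)) 1,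
    k 0 ⟪x, (ω : EuclideanSpace ℝ (Fin 3))⟫_ℝ * Y ω ∂sphereMeasure with hG₀
  set Ψ : ℕ → EuclideanSpace ℝ (Fin 3) → ℝ := fun l y => ∫ ω' : sphere (0 : EuclideanSpace ℝ (Fin 3)) 1,
    (legendre l).eval ⟪y, (ω' : EuclideanSpace ℝ (Fin 3))⟫_ℝ * Y ω' ∂sphereMeasure with hΨ
  set a : ℕ → ℝ := fun l => (2 * (l : ℝ) + 1) / 2 * ∫ z in (-1:ℝ)..1, k 0 z * (legendre l).eval z with ha
  set lam : ℕ → ℕ → ℝ := fun i l => 2 * π * ∫ z in (-1:ℝ)..1, k (i + 1) z * (legendre l).eval z with hlam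
  set I : ℕ → ℝ := fun L => ∫ t in (-1:ℝ)..1,
    |k 0 t - ∑ l ∈ Finset.range L, (2 * (l : ℝ) + 1) / 2 * (∫ z in (-1:ℝ)..1, k 0 z * (legendre l).eval z) *
      (legendre l).eval t| with hI
  set Pk : ℕ → ℝ := fun i => ∏ i' ∈ Finset.range i, (2 * π * ∫ t in (-1:ℝ)..1, |k (i' + 1) t|) with hPk
  have hIt : Tendsto I atTop (𝓝 0) := tendsto_integral_abs_sub_legendreSum hqm hM
  have hG₀m : Measurable G₀ := measurable_integral_sphere_zonal_mul hqm hY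
  -- Step 1: the innermost step along the Legendre partial sums of `k 0`
  have base : ∀ (L : ℕ) (x : EuclideanSpace ℝ (Fin 3)), ‖x‖ = 1 →
      |G₀ x - ∑ l ∈ Finset.range L, a l * Ψ l x| ≤ 2 * π * I L * m := by
    intro L x hx
    have hSc : Continuous fun t : ℝ => ∑ l ∈ Finset.range L, a l * (legendre l).eval t :=
      continuous_finsetSum _ fun l _ => continuous_const.mul (legendre l).continuous
    have hPY : ∀ l, Integrable (fun ω : sphere (0 : EuclideanSpace ℝ (Fin 3)) 1 =>
        a l * ((legendre l).eval ⟪x, (ω : EuclideanSpace ℝ (Fin 3))⟫_ℝ * Y ω)) sphereMeasure := fun l =>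
      (integrable_sphere_zonal_mul (k := fun t => (legendre l).eval t) hx
        ((legendre l).continuous.intervalIntegrable _ _) hY hm).const_mul (a l)
    have hdec : G₀ x - ∑ l ∈ Finset.range L, a l * Ψ l x =
        ∫ ω : sphere (0 : EuclideanSpace ℝ (Fin 3)) 1, (k 0 ⟪x, (ω : EuclideanSpace ℝ (Fin 3))⟫_ℝ -
          ∑ l ∈ Finset.range L, a l * (legendre l).eval ⟪x, (ω : EuclideanSpace ℝ (Fin 3))⟫_ℝ) * Y ω ∂sphereMeasure := by
      simp only [hG₀, hΨ, ← integral_const_mul]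
      rw [← integral_finsetSum _ (fun l _ => hPY l),
        ← integral_sub (integrable_sphere_zonal_mul hx hqI hY hm) (integrable_finsetSum _ fun l _ => hPY l)]
      refine integral_congr_ae (Eventually.of_forall fun ω => ?_)
      simp only [sub_mul, Finset.sum_mul, mul_assoc]
    rw [hdec]
    exact abs_integral_sphere_zonal_mul_le (k := fun t => k 0 t - ∑ l ∈ Finset.range L, a l * (legendre l).eval t)
      hx (hqI.sub (hSc.intervalIntegrable _ _)) hm
  -- Step 2: the outer steps, by induction along the fold
  have claim : ∀ (L i : ℕ), i ≤ j → ∀ x : EuclideanSpace ℝ (Fin 3), ‖x‖ = 1 →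
      |List.foldl (fun (F : EuclideanSpace ℝ (Fin 3) → ℝ) (i : ℕ) (x : EuclideanSpace ℝ (Fin 3)) =>
          ∫ ω : sphere (0 : EuclideanSpace ℝ (Fin 3)) 1, k (i + 1) ⟪x, (ω : EuclideanSpace ℝ (Fin 3))⟫_ℝ * F ω
            ∂sphereMeasure) G₀ (List.range i) x -
        ∑ l ∈ Finset.range L, (a l * ∏ i' ∈ Finset.range i, lam i' l) * Ψ l x| ≤ Pk i * (2 * π * I L * m) := by
    intro L i
    induction i with
    | zero =>
      intro _ x hx
      simpa [hPk] using base L x hx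
    | succ i ih =>
      intro hi x hx
      simp only [List.range_succ, List.foldl_append, List.foldl_cons, List.foldl_nil]
      have hGm : Measurable (List.foldl (fun (F : EuclideanSpace ℝ (Fin 3) → ℝ) (i : ℕ) (x : EuclideanSpace ℝ (Fin 3)) =>
          ∫ ω : sphere (0 : EuclideanSpace ℝ (Fin 3)) 1, k (i + 1) ⟪x, (ω : EuclideanSpace ℝ (Fin 3))⟫_ℝ * F ω
            ∂sphereMeasure) G₀ (List.range i)) :=
        measurable_foldl_zonal (k := fun i => k (i + 1)) hG₀m i fun i' hi' => hk (i' + 1) (by omega)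
      have h := abs_zonal_sub_sum_legendreOp_le (hk (i + 1) (by omega)) (hkI (i + 1) (by omega)) hY hm hGm
        (fun l => a l * ∏ i' ∈ Finset.range i, lam i' l) L (fun y hy => ih (by omega) y hy) hx
      have hs : ∑ l ∈ Finset.range L, (a l * ∏ i' ∈ Finset.range (i + 1), lam i' l) * Ψ l x =
          ∑ l ∈ Finset.range L, ((a l * ∏ i' ∈ Finset.range i, lam i' l) * lam i l) * Ψ l x :=
        Finset.sum_congr rfl fun l _ => by rw [Finset.prod_range_succ]; ring
      rw [hs]
      refine h.trans (le_of_eq ?_)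
      simp only [hPk]
      rw [Finset.prod_range_succ]
      ring
  -- Step 3: pairing with `Y`; the modes `ℓ = 0, 1` drop out
  have hΨ0 : Ψ 0 n = 0 := by simp [hΨ, legendre_zero, h0]
  have hΨ1 : Ψ 1 n = 0 := by
    have h := integral_inner (𝕜 := ℝ) (integrable_smul_sphere (integrable_sphere_of_abs_le hY hm)) n
    simp_rw [inner_smul_right] at h
    rw [h1, inner_zero_right] at h
    simpa [hΨ, legendre_one, mul_comm] using h
  -- Step 4: the estimate at level `N`
  have bound : ∀ N : ℕ,
      |List.foldl (fun (F : EuclideanSpace ℝ (Fin 3) → ℝ) (i : ℕ) (x : EuclideanSpace ℝ (Fin 3)) =>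
          ∫ ω : sphere (0 : EuclideanSpace ℝ (Fin 3)) 1, k (i + 1) ⟪x, (ω : EuclideanSpace ℝ (Fin 3))⟫_ℝ * F ω
            ∂sphereMeasure) G₀ (List.range j) n| ≤ Pk j * (2 * π * I (N + 2) * m) + θ * m := by
    intro N
    have hc := claim (N + 2) j le_rfl n hn
    have hS : |∑ l ∈ Finset.range (N + 2), (a l * ∏ i' ∈ Finset.range j, lam i' l) * Ψ l n| ≤ θ * m := by
      rw [Finset.sum_range_succ', Finset.sum_range_succ']
      simp only [hΨ0, hΨ1, mul_zero, add_zero]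
      calc |∑ l ∈ Finset.range N, (a (l + 1 + 1) * ∏ i' ∈ Finset.range j, lam i' (l + 1 + 1)) * Ψ (l + 1 + 1) n|
          ≤ ∑ l ∈ Finset.range N, |(a (l + 1 + 1) * ∏ i' ∈ Finset.range j, lam i' (l + 1 + 1)) * Ψ (l + 1 + 1) n| :=
            Finset.abs_sum_le_sum_abs _ _
        _ ≤ ∑ l ∈ Finset.range N, (2 * ((l + 2 : ℕ) : ℝ) + 1) / 2 *
            (∫ x in (-1:ℝ)..1, |(legendre (l + 2)).eval x|) *
            (∏ i ∈ Finset.range (j + 1), |2 * π * ∫ z in (-1:ℝ)..1, k i z * (legendre (l + 2)).eval z|) * m := by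
            refine Finset.sum_le_sum fun l _ => ?_
            rw [show l + 1 + 1 = l + 2 by ring, abs_mul, abs_mul, Finset.abs_prod]
            refine (mul_le_mul_of_nonneg_left (abs_legendreOp_le (l + 2) hm hn) (by positivity)).trans (le_of_eq ?_)
            have hal : |a (l + 2)| = (2 * ((l + 2 : ℕ) : ℝ) + 1) / 2 *
                |∫ z in (-1:ℝ)..1, k 0 z * (legendre (l + 2)).eval z| := by
              rw [ha]
              dsimp only
              rw [abs_mul, abs_of_pos (by positivity : (0:ℝ) < (2 * ((l + 2 : ℕ) : ℝ) + 1) / 2)]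
            have hl0 : |2 * π * ∫ z in (-1:ℝ)..1, k 0 z * (legendre (l + 2)).eval z| =
                2 * π * |∫ z in (-1:ℝ)..1, k 0 z * (legendre (l + 2)).eval z| := by
              rw [abs_mul, abs_of_pos (by positivity : (0:ℝ) < 2 * π)]
            rw [hal, Finset.prod_range_succ', hl0]
            simp only [hlam]
            ring
        _ ≤ θ * m := by rw [← Finset.sum_mul]; exact mul_le_mul_of_nonneg_right (hθ N) hm0
    have h3 := (abs_sub_abs_le_abs_sub _ _).trans hc
    linarith
  -- Step 5: `N → ∞`
  have hlim : Tendsto (fun N : ℕ => Pk j * (2 * π * I (N + 2) * m) + θ * m) atTop (𝓝 (θ * m)) := by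
    have h := ((((hIt.comp (tendsto_add_atTop_nat 2)).const_mul (2 * π)).mul_const m).const_mul
      (Pk j)).add_const (θ * m)
    simpa using h
  exact ge_of_tendsto' hlim bound

/-! ### Registered helpers -/

/-- **Registered helper `t12_comp_zonal_legendre` — the Legendre multipliers of a composite of DIFFERENT zonal
operators multiply.** For unit vectors `n, n'` of `ℝ³`, zonal weights `k_i : ℝ → ℝ` (measurable, integrable on
`[-1, 1]` for `i < j`) and every `ℓ`: the composite `K_{k_{j-1}} ∘ ⋯ ∘ K_{k_0}` of the zonal operators
`(K_k F)(x) = ∫_{S²} k(⟪x, ω⟫) F(ω) dσ(ω)` — the fold `List.foldl (fun F i x => ∫ k_i(⟪x, ω⟫) F(ω) dσ(ω)) · (List.range j)`,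
`k_0` acting first — maps the zonal harmonic `P_ℓ(⟪n', ·⟫)` of any pole to `(Π_{i<j} λ_ℓ(k_i)) P_ℓ(⟪n, ·⟫)`,
`λ_ℓ(k) = 2π ∫_{-1}^{1} k P_ℓ` (`t12_funkHecke_legendre`, iterated): products of different collision steps act on
degree `ℓ` by `Π_i λ_ℓ(k_i)` — the "`Π_i P_ℓ(ρ_i)`" of plan §6 FF6 after averaging. [folklore] -/
theorem t12_comp_zonal_legendre : ∀ (ℓ j : ℕ) (n n' : EuclideanSpace ℝ (Fin 3)), ‖n‖ = 1 → ‖n'‖ = 1 → ∀ k : ℕ → ℝ → ℝ, (∀ i < j, Measurable (k i)) → (∀ i < j, IntervalIntegrable (k i) MeasureTheory.volume (-1) 1) → List.foldl (fun (F : EuclideanSpace ℝ (Fin 3) → ℝ) (i : ℕ) (x : EuclideanSpace ℝ (Fin 3)) => ∫ ω : Metric.sphere (0 : EuclideanSpace ℝ (Fin 3)) 1, k i (inner ℝ x (ω : EuclideanSpace ℝ (Fin 3))) * F (ω : EuclideanSpace ℝ (Fin 3)) ∂Literature.MathematicalPhysics.KineticTheory.sphereMeasure) (fun x : EuclideanSpace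 ℝ (Fin 3) => (Literature.Analysis.SpecialFunctions.legendre ℓ).eval (inner ℝ n' x)) (List.range j) n = (∏ i ∈ Finset.range j, (2 * Real.pi * ∫ z in (-1 : ℝ)..1, k i z * (Literature.Analysis.SpecialFunctions.legendre ℓ).eval z)) * (Literature.Analysis.SpecialFunctions.legendre ℓ).eval (inner ℝ n n') :=
  fun ℓ j _ _ hn hn' _ hk hkI => foldl_zonal_legendre ℓ hn' j hk hkI hn

/-- **Registered helper `t12_comp_zonal_contraction_sup` — the `ℓ ≥ 2` sup-norm bound of a composite of
DIFFERENT zonal operators from the products of their Legendre multipliers.** Let `k_0, …, k_{j-1} : ℝ → ℝ`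
(`j ≥ 1`) be zonal weights, measurable and integrable on `[-1, 1]`, the FIRST-APPLIED one `k_0` moreover bounded
(`|k_0| ≤ M` on `[-1, 1]`); `λ_ℓ(k) = 2π ∫_{-1}^{1} k P_ℓ`; suppose `Σ_{ℓ=2}^{N+1} (2ℓ+1)/2 ‖P_ℓ‖_{L¹[-1,1]} Π_{i<j} |λ_ℓ(k_i)| ≤ θ`
for all `N`. Then every measurable `Y : ℝ³ → ℝ` with `|Y| ≤ m` on the unit sphere, ZERO ZONAL AVERAGE
`∫ Y dσ = 0` and ZERO DIPOLE MOMENT `∫ Y(ω) ω dσ(ω) = 0` satisfies at every unit `n`: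
`|(K_{k_{j-1}} ∘ ⋯ ∘ K_{k_0} Y)(n)| ≤ θ m`, the composite being the fold
`List.foldl (fun F i x => ∫_{S²} k_i(⟪x, ω⟫) F(ω) dσ(ω)) Y (List.range j)` — `‖K_{k_{j-1}} ⋯ K_{k_0}‖_{L^∞ → L^∞, ℓ ≥ 2} ≤`
`Σ_{ℓ≥2} (2ℓ+1)/2 ‖P_ℓ‖₁ Π_i |λ_ℓ(k_i)|`: plan §6 FF6 (i) for products of different collision steps, with the SAME
constant as the one-kernel case `t12_iterate_zonal_contraction_sup` (`k_i = k`). Ingredients: Legendre series of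
`k_0` in `L¹` (`t12_legendre_series_L1`), the commutation `K_k Π_ℓ = λ_ℓ(k) Π_ℓ` of every `L¹` zonal operator with
`Π_ℓ Y = ∫ P_ℓ(⟪·, ω'⟫) Y(ω') dσ(ω')` (Fubini + `t12_funkHecke_legendre`), the sup bounds `2π‖k_i‖₁`, and duality
(modes `ℓ = 0, 1` annihilated by `Y`, `|Π_ℓ Y| ≤ 2π‖P_ℓ‖₁ m`). [folklore] -/
theorem t12_comp_zonal_contraction_sup : ∀ (k : ℕ → ℝ → ℝ) (M : ℝ) (j : ℕ), 0 < j → (∀ i < j, Measurable (k i)) → (∀ t ∈ Set.Icc (-1 : ℝ) 1, |k 0 t| ≤ M) → (∀ i < j, IntervalIntegrable (k i) MeasureTheory.volume (-1) 1) → ∀ θ : ℝ, (∀ N : ℕ, ∑ ℓ ∈ Finset.range N, (2 * ((ℓ + 2 : ℕ) : ℝ) + 1) / 2 * (∫ x in (-1 : ℝ)..1, |(Literature.Analysis.SpecialFunctions.legendre (ℓ + 2)).eval x|) * ∏ i ∈ Finset.range j, |2 * Real.pi * ∫ z in (-1 : ℝ)..1, k i z * (Literature.Analysis.SpecialFunctions.legendre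 (ℓ + 2)).eval z| ≤ θ) → ∀ (Y : EuclideanSpace ℝ (Fin 3) → ℝ) (m : ℝ), Measurable Y → (∀ x : EuclideanSpace ℝ (Fin 3), ‖x‖ = 1 → |Y x| ≤ m) → ∫ ω : Metric.sphere (0 : EuclideanSpace ℝ (Fin 3)) 1, Y (ω : EuclideanSpace ℝ (Fin 3)) ∂Literature.MathematicalPhysics.KineticTheory.sphereMeasure = 0 → ∫ ω : Metric.sphere (0 : EuclideanSpace ℝ (Fin 3)) 1, Y (ω : EuclideanSpace ℝ (Fin 3)) • (ω : EuclideanSpace ℝ (Fin 3)) ∂Literature.MathematicalPhysics.KineticTheory.sphereMeasure = 0 → ∀ n : EuclideanSpace ℝ (Fin 3), ‖n‖ = 1 → |List.foldl (fun (F : EuclideanSpace ℝ (Fin 3) → ℝ) (i : ℕ) (x : EuclideanSpace ℝ (Fin 3)) => ∫ ω : Metric.sphere (0 : EuclideanSpace ℝ (Fin 3)) 1, k i (inner ℝ x (ω : EuclideanSpace ℝ (Fin 3))) * F (ω : EuclideanSpace ℝ (Fin 3)) ∂Literature.MathematicalPhysics.KineticTheory.sphereMeasure) Y (List.range j) n|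 ≤ θ * m :=
  fun _ _ _ hj hk hM hkI _ hθ _ _ hY hm h0 h1 _ hn =>
    abs_foldl_zonal_le_of_orthogonal hj hk hM hkI hθ hY hm h0 h1 hn

end Summit.AtomisticToContinuum.HydrodynamicLimit.Theorems.ClampedCorrectorBirth

end
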